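import Mathlib
import Summits.CriticalPhenomena.Ising3DConformalLimit.Theses.HarmonicMomentsIsotropy
import Summits.CriticalPhenomena.Ising3DConformalLimit.Theorems.HarmonicMomentsIsotropyHarmonicDilutionInvariantHierarchy
import Summits.CriticalPhenomena.Ising3DConformalLimit.Theorems.HarmonicMomentsIsotropyHarmonicDilutionQuarticSymmetrization
import Summits.CriticalPhenomena.Ising3DConformalLimit.Theorems.HarmonicMomentsIsotropyHarmonicDilutionQuartic
import HarnessLib

/-!
# Route HarmonicMomentsIsotropy — the quartic level of the hierarchy is the `K₄` family

Continuation of `HarmonicMomentsIsotropyHarmonicDilutionInvariantHierarchy.lean` for item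
`stmt-CriticalPhenomena-6034` (`HarmonicDilution`).  There, the crux `AngularHierarchy`
(stmt-CriticalPhenomena-6031: contraction of the `β`-increments of the harmonic moments
`k_{Y,m}(β) = ∑_x Y(x)|x|^{2m}⟨σ₀σ_x⟩^∅_β` against those of `M_{n+2m}(β) = ∑_x |x|^{n+2m}⟨σ₀σ_x⟩^∅_β`,
inductively in `q = n + 2m`) was reduced to the `B₃`-invariant harmonics of even degree `n ≥ 4`.
Here the quartic level is identified with a single explicit family:

* `angularHierarchy_iff_K4_and_invariant_six_le` — `AngularHierarchy` is equivalent to the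
  conjunction of (i) for every radial order `m`, given that all anisotropy ratios of total degree
  `< 4 + 2m` tend to `0`, the contraction for the ONE moment
  `k_{K₄,m}(β) = ∑_x (∑ xᵢ⁴ - (3/5)|x|⁴)|x|^{2m}⟨σ₀σ_x⟩^∅_β`, and (ii) the invariant hierarchy in even
  degrees `n ≥ 6` (`K₆, K₈, K₁₀`, the invariant plane in degree `12`, …);
* `harmonicDilution_of_K4_hierarchy` — the corresponding sufficient hypothesis for the item;
* `lowerRatios_below_four`, `angularHierarchy_K4_zero` — at the bottom level `q = 4` the induction
  hypothesis holds outright (degrees `≤ 3`: `harmonicDilution_of_degree_le_three`), so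
  `AngularHierarchy` contains the UNCONDITIONAL contraction statement for `(K₄, m = 0)`, the
  decisive first instance named in the route text (CPRV's `q_{4,0}` against `m₄`).

Mechanism: in degree `4`, `k_{Y,m} = (5/6)c_A(Y) · k_{K₄,m}` on `[0, β_c)` for every harmonic
homogeneous quartic `Y` (`harmonicMoment_degree_four`), and the contraction transports along scalar
relations (`contraction_transfer`).
-/

namespace Summit.CriticalPhenomena.Ising3DConformalLimit.Theorems

open Filter Topology Set
open scoped Pointwise
open Literature.Probability.LatticeModels
open Summit.CriticalPhenomena.Ising3DConformalLimit.Theses.HarmonicMomentsIsotropy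

/-! ### The bottom of the induction -/

/-- The induction hypothesis of the hierarchy at the bottom level `q = 4` holds unconditionally:
every harmonic homogeneous `Y` of degree `1 ≤ n` with `n + 2m < 4` has `n ≤ 3`, where the ratios
vanish identically (`harmonicDilution_of_degree_le_three`). -/
theorem lowerRatios_below_four :
    (∀ (n' m' : ℕ) (Y' : MvPolynomial (Fin 3) ℝ), 1 ≤ n' → n' + 2 * m' < 4 →
      Y'.IsHomogeneous n' → (∑ i : Fin 3, MvPolynomial.pderiv i (MvPolynomial.pderiv i Y')) = 0 →
      Tendsto (fun β => (∑' x : Site 3, MvPolynomial.eval (fun i => ((x i : ℤ) : ℝ)) Y' *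
            Real.sqrt (∑ i, ((x i : ℤ) : ℝ) ^ 2) ^ (2 * m') * twoPointFree 3 β x) /
          (∑' x : Site 3,
            Real.sqrt (∑ i, ((x i : ℤ) : ℝ) ^ 2) ^ (n' + 2 * m') * twoPointFree 3 β x))
        (𝓝[<] criticalBeta 3) (𝓝 0)) := by
  intro n m Y hn hlt hY hΔ
  exact harmonicDilution_of_degree_le_three n m Y hn (by omega) hY hΔ

/-! ### The quartic level of the hierarchy is the `K₄` family -/

/-- **The crux, fully reduced.**  `AngularHierarchy` is equivalent to the conjunction of
(i) for every radial order `m`: given that all anisotropy ratios of total degree `< 4 + 2m` tend to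
`0`, the contraction of the `β`-increments of the single moment
`k_{K₄,m}(β) = ∑_x (∑ xᵢ⁴ - (3/5)|x|⁴)|x|^{2m}⟨σ₀σ_x⟩^∅_β` against those of `M_{4+2m}`; and
(ii) the invariant hierarchy in even degrees `n ≥ 6` (`K₆, K₈, K₁₀`, the invariant plane in
degree `12`, …).  In degree `4`, `k_{Y,m} = (5/6)c_A(Y)·k_{K₄,m}` for every harmonic homogeneous
quartic `Y` (`harmonicMoment_degree_four`), so the contraction transports from `K₄`. -/
theorem angularHierarchy_iff_K4_and_invariant_six_le :
    AngularHierarchy ↔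
      ((
        ∀ m : ℕ,
          (∀ (n' m' : ℕ) (Y' : MvPolynomial (Fin 3) ℝ), 1 ≤ n' → n' + 2 * m' < 4 + 2 * m →
            Y'.IsHomogeneous n' → (∑ i : Fin 3, MvPolynomial.pderiv i (MvPolynomial.pderiv i Y')) = 0 →
            Tendsto (fun β => (∑' x : Site 3, MvPolynomial.eval (fun i => ((x i : ℤ) : ℝ)) Y' *
                  Real.sqrt (∑ i, ((x i : ℤ) : ℝ) ^ 2) ^ (2 * m') * twoPointFree 3 β x) /
                (∑' x : Site 3,
                  Real.sqrt (∑ i, ((x i : ℤ) : ℝ) ^ 2) ^ (n' + 2 * m') * twoPointFree 3 β x))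
              (𝓝[<] criticalBeta 3) (𝓝 0)) →
          ∃ θ : ℝ, θ < 1 ∧ ∀ ε : ℝ, 0 < ε → ∃ β₀ : ℝ, β₀ < criticalBeta 3 ∧ ∀ β₁ β₂ : ℝ,
            β₀ ≤ β₁ → β₁ < β₂ → β₂ < criticalBeta 3 →
            |(∑' x : Site 3, ((∑ i : Fin 3, ((x i : ℤ) : ℝ) ^ 4) - 3 / 5 * (∑ i : Fin 3, ((x i : ℤ) : ℝ) ^ 2) ^ 2) *
                  Real.sqrt (∑ i, ((x i : ℤ) : ℝ) ^ 2) ^ (2 * m) * twoPointFree 3 β₂ x) -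
                (∑' x : Site 3, ((∑ i : Fin 3, ((x i : ℤ) : ℝ) ^ 4) - 3 / 5 * (∑ i : Fin 3, ((x i : ℤ) : ℝ) ^ 2) ^ 2) *
                    Real.sqrt (∑ i, ((x i : ℤ) : ℝ) ^ 2) ^ (2 * m) * twoPointFree 3 β₁ x)| ≤
              (θ * sSup ((fun β => |(∑' x : Site 3, ((∑ i : Fin 3, ((x i : ℤ) : ℝ) ^ 4) - 3 / 5 * (∑ i : Fin 3, ((x i : ℤ) : ℝ) ^ 2) ^ 2) *
                      Real.sqrt (∑ i, ((x i : ℤ) : ℝ) ^ 2) ^ (2 * m) * twoPointFree 3 β x) /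
                  (∑' x : Site 3,
                    Real.sqrt (∑ i, ((x i : ℤ) : ℝ) ^ 2) ^ (4 + 2 * m) * twoPointFree 3 β x)|) '' Set.Icc β₁ β₂) + ε) *
                ((∑' x : Site 3,
                  Real.sqrt (∑ i, ((x i : ℤ) : ℝ) ^ 2) ^ (4 + 2 * m) * twoPointFree 3 β₂ x) -
                  (∑' x : Site 3,
                    Real.sqrt (∑ i, ((x i : ℤ) : ℝ) ^ 2) ^ (4 + 2 * m) * twoPointFree 3 β₁ x))) ∧
      ∀ q : ℕ,
        (∀ (n' m' : ℕ) (Y' : MvPolynomial (Fin 3) ℝ), 1 ≤ n' → n' + 2 * m' < q →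
          Y'.IsHomogeneous n' → (∑ i : Fin 3, MvPolynomial.pderiv i (MvPolynomial.pderiv i Y')) = 0 →
          Tendsto (fun β => (∑' x : Site 3, MvPolynomial.eval (fun i => ((x i : ℤ) : ℝ)) Y' *
                Real.sqrt (∑ i, ((x i : ℤ) : ℝ) ^ 2) ^ (2 * m') * twoPointFree 3 β x) /
              (∑' x : Site 3,
                Real.sqrt (∑ i, ((x i : ℤ) : ℝ) ^ 2) ^ (n' + 2 * m') * twoPointFree 3 β x))
            (𝓝[<] criticalBeta 3) (𝓝 0)) →
        ∀ (n m : ℕ) (Y : MvPolynomial (Fin 3) ℝ), 6 ≤ n → Even n → n + 2 * m = q →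
          Y.IsHomogeneous n → (∑ i : Fin 3, MvPolynomial.pderiv i (MvPolynomial.pderiv i Y)) = 0 →
          (∀ (π : Equiv.Perm (Fin 3)) (ε : Fin 3 → ℤˣ) (v : Fin 3 → ℝ),
            MvPolynomial.eval (fun i => ((ε i : ℤ) : ℝ) * v (π.symm i)) Y = MvPolynomial.eval v Y) →
          ∃ θ : ℝ, θ < 1 ∧ ∀ ε : ℝ, 0 < ε → ∃ β₀ : ℝ, β₀ < criticalBeta 3 ∧ ∀ β₁ β₂ : ℝ,
            β₀ ≤ β₁ → β₁ < β₂ → β₂ < criticalBeta 3 →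
            |(∑' x : Site 3, MvPolynomial.eval (fun i => ((x i : ℤ) : ℝ)) Y *
                  Real.sqrt (∑ i, ((x i : ℤ) : ℝ) ^ 2) ^ (2 * m) * twoPointFree 3 β₂ x) -
                (∑' x : Site 3, MvPolynomial.eval (fun i => ((x i : ℤ) : ℝ)) Y *
                    Real.sqrt (∑ i, ((x i : ℤ) : ℝ) ^ 2) ^ (2 * m) * twoPointFree 3 β₁ x)| ≤
              (θ * sSup ((fun β => |(∑' x : Site 3, MvPolynomial.eval (fun i => ((x i : ℤ) : ℝ)) Y *
                      Real.sqrt (∑ i, ((x i : ℤ) : ℝ) ^ 2) ^ (2 * m) * twoPointFree 3 β x) /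
                  (∑' x : Site 3,
                    Real.sqrt (∑ i, ((x i : ℤ) : ℝ) ^ 2) ^ (n + 2 * m) * twoPointFree 3 β x)|) '' Set.Icc β₁ β₂) + ε) *
                ((∑' x : Site 3,
                  Real.sqrt (∑ i, ((x i : ℤ) : ℝ) ^ 2) ^ (n + 2 * m) * twoPointFree 3 β₂ x) -
                  (∑' x : Site 3,
                    Real.sqrt (∑ i, ((x i : ℤ) : ℝ) ^ 2) ^ (n + 2 * m) * twoPointFree 3 β₁ x))) := by
  have hβc : 0 < criticalBeta 3 := criticalBeta_pos_holds (by norm_num)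
  constructor
  · intro hAH
    refine ⟨fun m ih => ?_, fun q ih n m Y hn he hq hY hΔ hinv =>
      (angularHierarchy_iff_invariant.1 hAH) q ih n m Y (by omega) he hq hY hΔ hinv⟩
    dsimp only [AngularHierarchy] at hAH
    obtain ⟨θ, hθ, hc⟩ := hAH (4 + 2 * m) ih 4 m _ (by norm_num) rfl K4poly_isHomogeneous
      K4poly_harmonic
    refine ⟨θ, hθ, contraction_transfer (c := 1) (θ := θ)
      (k₁ := fun β => (∑' x : Site 3, MvPolynomial.eval (fun i => ((x i : ℤ) : ℝ))
          (∑ i : Fin 3, MvPolynomial.X i ^ 4 -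
            MvPolynomial.C (3 / 5 : ℝ) * (∑ i : Fin 3, MvPolynomial.X i ^ 2) ^ 2 :
              MvPolynomial (Fin 3) ℝ) *
          Real.sqrt (∑ i, ((x i : ℤ) : ℝ) ^ 2) ^ (2 * m) * twoPointFree 3 β x))
      (k₂ := fun β => (∑' x : Site 3, ((∑ i : Fin 3, ((x i : ℤ) : ℝ) ^ 4) - 3 / 5 * (∑ i : Fin 3, ((x i : ℤ) : ℝ) ^ 2) ^ 2) *
            Real.sqrt (∑ i, ((x i : ℤ) : ℝ) ^ 2) ^ (2 * m) * twoPointFree 3 β x))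
      (M := fun β => (∑' x : Site 3,
            Real.sqrt (∑ i, ((x i : ℤ) : ℝ) ^ 2) ^ (4 + 2 * m) * twoPointFree 3 β x))
      hβc (fun β _ _ => ?_) (isotropicMoment_mono (4 + 2 * m)) hc⟩
    show _ = 1 * _
    rw [one_mul]
    exact tsum_congr fun x => by rw [eval_K4poly]
  · rintro ⟨hK4, h6⟩
    rw [angularHierarchy_iff_invariant]
    intro q ih n m Y hn he hq hY hΔ hinv
    rcases Nat.lt_or_ge n 6 with hlt | hge
    · have hn4 : n = 4 := by
        obtain ⟨k, rfl⟩ := he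
        omega
      subst hn4
      subst hq
      obtain ⟨θ, hθ, hc⟩ := hK4 m ih
      exact ⟨θ, hθ, contraction_transfer (θ := θ)
        (c := 5 / 6 * (Y.coeff (Finsupp.single 0 4) + Y.coeff (Finsupp.single 1 4) +
          Y.coeff (Finsupp.single 2 4)))
        (k₁ := fun β => (∑' x : Site 3, ((∑ i : Fin 3, ((x i : ℤ) : ℝ) ^ 4) - 3 / 5 * (∑ i : Fin 3, ((x i : ℤ) : ℝ) ^ 2) ^ 2) *
              Real.sqrt (∑ i, ((x i : ℤ) : ℝ) ^ 2) ^ (2 * m) * twoPointFree 3 β x))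
        (k₂ := fun β => (∑' x : Site 3, MvPolynomial.eval (fun i => ((x i : ℤ) : ℝ)) Y *
              Real.sqrt (∑ i, ((x i : ℤ) : ℝ) ^ 2) ^ (2 * m) * twoPointFree 3 β x))
        (M := fun β => (∑' x : Site 3,
            Real.sqrt (∑ i, ((x i : ℤ) : ℝ) ^ 2) ^ (4 + 2 * m) * twoPointFree 3 β x))
        hβc (fun β hβ0 hβ => harmonicMoment_degree_four hβ0 hβ Y hY hΔ m)
        (isotropicMoment_mono (4 + 2 * m)) hc⟩
    · exact h6 q ih n m Y hge he hq hY hΔ hinv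

/-- **The item from the `K₄` hierarchy.**  `HarmonicDilution` follows from (i) the contraction for
the `K₄` moments at every radial order (given the lower ratios) and (ii) the invariant hierarchy in
even degrees `n ≥ 6`. -/
theorem harmonicDilution_of_K4_hierarchy
    (hK4 :
      ∀ m : ℕ,
        (∀ (n' m' : ℕ) (Y' : MvPolynomial (Fin 3) ℝ), 1 ≤ n' → n' + 2 * m' < 4 + 2 * m →
          Y'.IsHomogeneous n' → (∑ i : Fin 3, MvPolynomial.pderiv i (MvPolynomial.pderiv i Y')) = 0 →
          Tendsto (fun β => (∑' x : Site 3, MvPolynomial.eval (fun i => ((x i : ℤ) : ℝ)) Y' *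
                Real.sqrt (∑ i, ((x i : ℤ) : ℝ) ^ 2) ^ (2 * m') * twoPointFree 3 β x) /
              (∑' x : Site 3,
                Real.sqrt (∑ i, ((x i : ℤ) : ℝ) ^ 2) ^ (n' + 2 * m') * twoPointFree 3 β x))
            (𝓝[<] criticalBeta 3) (𝓝 0)) →
        ∃ θ : ℝ, θ < 1 ∧ ∀ ε : ℝ, 0 < ε → ∃ β₀ : ℝ, β₀ < criticalBeta 3 ∧ ∀ β₁ β₂ : ℝ,
          β₀ ≤ β₁ → β₁ < β₂ → β₂ < criticalBeta 3 →
          |(∑' x : Site 3, ((∑ i : Fin 3, ((x i : ℤ) : ℝ) ^ 4) - 3 / 5 * (∑ i : Fin 3, ((x i : ℤ) : ℝ) ^ 2) ^ 2) *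
                Real.sqrt (∑ i, ((x i : ℤ) : ℝ) ^ 2) ^ (2 * m) * twoPointFree 3 β₂ x) -
              (∑' x : Site 3, ((∑ i : Fin 3, ((x i : ℤ) : ℝ) ^ 4) - 3 / 5 * (∑ i : Fin 3, ((x i : ℤ) : ℝ) ^ 2) ^ 2) *
                  Real.sqrt (∑ i, ((x i : ℤ) : ℝ) ^ 2) ^ (2 * m) * twoPointFree 3 β₁ x)| ≤
            (θ * sSup ((fun β => |(∑' x : Site 3, ((∑ i : Fin 3, ((x i : ℤ) : ℝ) ^ 4) - 3 / 5 * (∑ i : Fin 3, ((x i : ℤ) : ℝ) ^ 2) ^ 2) *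
                    Real.sqrt (∑ i, ((x i : ℤ) : ℝ) ^ 2) ^ (2 * m) * twoPointFree 3 β x) /
                (∑' x : Site 3,
                  Real.sqrt (∑ i, ((x i : ℤ) : ℝ) ^ 2) ^ (4 + 2 * m) * twoPointFree 3 β x)|) '' Set.Icc β₁ β₂) + ε) *
              ((∑' x : Site 3,
                Real.sqrt (∑ i, ((x i : ℤ) : ℝ) ^ 2) ^ (4 + 2 * m) * twoPointFree 3 β₂ x) -
                (∑' x : Site 3,
                  Real.sqrt (∑ i, ((x i : ℤ) : ℝ) ^ 2) ^ (4 + 2 * m) * twoPointFree 3 β₁ x)))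
    (h6 :
      ∀ q : ℕ,
        (∀ (n' m' : ℕ) (Y' : MvPolynomial (Fin 3) ℝ), 1 ≤ n' → n' + 2 * m' < q →
          Y'.IsHomogeneous n' → (∑ i : Fin 3, MvPolynomial.pderiv i (MvPolynomial.pderiv i Y')) = 0 →
          Tendsto (fun β => (∑' x : Site 3, MvPolynomial.eval (fun i => ((x i : ℤ) : ℝ)) Y' *
                Real.sqrt (∑ i, ((x i : ℤ) : ℝ) ^ 2) ^ (2 * m') * twoPointFree 3 β x) /
              (∑' x : Site 3,
                Real.sqrt (∑ i, ((x i : ℤ) : ℝ) ^ 2) ^ (n' + 2 * m') * twoPointFree 3 β x))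
            (𝓝[<] criticalBeta 3) (𝓝 0)) →
        ∀ (n m : ℕ) (Y : MvPolynomial (Fin 3) ℝ), 6 ≤ n → Even n → n + 2 * m = q →
          Y.IsHomogeneous n → (∑ i : Fin 3, MvPolynomial.pderiv i (MvPolynomial.pderiv i Y)) = 0 →
          (∀ (π : Equiv.Perm (Fin 3)) (ε : Fin 3 → ℤˣ) (v : Fin 3 → ℝ),
            MvPolynomial.eval (fun i => ((ε i : ℤ) : ℝ) * v (π.symm i)) Y = MvPolynomial.eval v Y) →
          ∃ θ : ℝ, θ < 1 ∧ ∀ ε : ℝ, 0 < ε → ∃ β₀ : ℝ, β₀ < criticalBeta 3 ∧ ∀ β₁ β₂ : ℝ,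
            β₀ ≤ β₁ → β₁ < β₂ → β₂ < criticalBeta 3 →
            |(∑' x : Site 3, MvPolynomial.eval (fun i => ((x i : ℤ) : ℝ)) Y *
                  Real.sqrt (∑ i, ((x i : ℤ) : ℝ) ^ 2) ^ (2 * m) * twoPointFree 3 β₂ x) -
                (∑' x : Site 3, MvPolynomial.eval (fun i => ((x i : ℤ) : ℝ)) Y *
                    Real.sqrt (∑ i, ((x i : ℤ) : ℝ) ^ 2) ^ (2 * m) * twoPointFree 3 β₁ x)| ≤
              (θ * sSup ((fun β => |(∑' x : Site 3, MvPolynomial.eval (fun i => ((x i : ℤ) : ℝ)) Y *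
                      Real.sqrt (∑ i, ((x i : ℤ) : ℝ) ^ 2) ^ (2 * m) * twoPointFree 3 β x) /
                  (∑' x : Site 3,
                    Real.sqrt (∑ i, ((x i : ℤ) : ℝ) ^ 2) ^ (n + 2 * m) * twoPointFree 3 β x)|) '' Set.Icc β₁ β₂) + ε) *
                ((∑' x : Site 3,
                  Real.sqrt (∑ i, ((x i : ℤ) : ℝ) ^ 2) ^ (n + 2 * m) * twoPointFree 3 β₂ x) -
                  (∑' x : Site 3,
                    Real.sqrt (∑ i, ((x i : ℤ) : ℝ) ^ 2) ^ (n + 2 * m) * twoPointFree 3 β₁ x))) :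
    HarmonicDilution :=
  harmonicDilution_of_angularHierarchy (angularHierarchy_iff_K4_and_invariant_six_le.2 ⟨hK4, h6⟩)

/-- **The decisive first instance, isolated.**  `AngularHierarchy` contains, with no hypothesis
left (the lower ratios of total degree `< 4` vanish identically, `lowerRatios_below_four`), the
contraction statement for the quartic cubic harmonic at radial order `0`: there is `θ < 1` such
that for every `ε > 0`, on some left neighbourhood of `β_c(3)`,
`|k_{K₄,0}(β₂) - k_{K₄,0}(β₁)| ≤ (θ · sup_{[β₁,β₂]} |k_{K₄,0}/M₄| + ε) · (M₄(β₂) - M₄(β₁))`,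
`k_{K₄,0}(β) = ∑_x (∑ xᵢ⁴ - (3/5)|x|⁴)⟨σ₀σ_x⟩^∅_β`, `M₄(β) = ∑_x |x|⁴⟨σ₀σ_x⟩^∅_β`. -/
theorem angularHierarchy_K4_zero (hAH : AngularHierarchy) :
    ∃ θ : ℝ, θ < 1 ∧ ∀ ε : ℝ, 0 < ε → ∃ β₀ : ℝ, β₀ < criticalBeta 3 ∧ ∀ β₁ β₂ : ℝ,
      β₀ ≤ β₁ → β₁ < β₂ → β₂ < criticalBeta 3 →
      |(∑' x : Site 3, ((∑ i : Fin 3, ((x i : ℤ) : ℝ) ^ 4) - 3 / 5 * (∑ i : Fin 3, ((x i : ℤ) : ℝ) ^ 2) ^ 2) *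
            twoPointFree 3 β₂ x) -
          (∑' x : Site 3, ((∑ i : Fin 3, ((x i : ℤ) : ℝ) ^ 4) - 3 / 5 * (∑ i : Fin 3, ((x i : ℤ) : ℝ) ^ 2) ^ 2) *
              twoPointFree 3 β₁ x)| ≤
        (θ * sSup ((fun β => |(∑' x : Site 3, ((∑ i : Fin 3, ((x i : ℤ) : ℝ) ^ 4) - 3 / 5 * (∑ i : Fin 3, ((x i : ℤ) : ℝ) ^ 2) ^ 2) *
                twoPointFree 3 β x) /
            (∑' x : Site 3, Real.sqrt (∑ i, ((x i : ℤ) : ℝ) ^ 2) ^ 4 * twoPointFree 3 β x)|) '' Set.Icc β₁ β₂) + ε) *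
          ((∑' x : Site 3, Real.sqrt (∑ i, ((x i : ℤ) : ℝ) ^ 2) ^ 4 * twoPointFree 3 β₂ x) -
            (∑' x : Site 3, Real.sqrt (∑ i, ((x i : ℤ) : ℝ) ^ 2) ^ 4 * twoPointFree 3 β₁ x)) := by
  have h := (angularHierarchy_iff_K4_and_invariant_six_le.1 hAH).1 0
    (by simpa using lowerRatios_below_four)
  simpa using h

end Summit.CriticalPhenomena.Ising3DConformalLimit.Theorems
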